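import Mathlib
import Summits.NavierStokesRegularity.NavierStokesRegularity.Theorems.FilamentSkeletonRssSkeletonJ1RLiaSelfReference

/-!
# Crux `SkeletonJ1R` (stmt-NavierStokesRegularity-23610) · line `streamline_kantorovich_R` · toward stub F2-d (`LiaDefectDerivBL`, v7):
# THE CURVATURE OF THE LIA REFERENCE ON THE SWITCHED REGION IS `O(1/ℓ)`, Γ-UNIFORMLY

Lead `ns-fsr-lead-23610` g2, `--supports stmt-NavierStokesRegularity-23610 --as helper`.  MODEL rung, NEGATIVE side of the ladder: estimates for a
HYPOTHETICAL filament-type blow-up skeleton; nothing here is a claim about Navier–Stokes regularity; the stub and the crux stay OPEN.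

`collar_curvature_mul_le` — under the hypotheses of the F2-B bricks (`IsLiaReference`, unit datum directions in general position `θg`, separation `ρd`,
tilt budget `θ₁`, `|γ| ∈ [θp, θp⁻¹]`, `|α| ≤ θp⁻¹`, waists `≤ Rwd`) and `|τ| ≤ 3ℓ` (the closed switched region, `…LiaResidualBound.abs_param_le_of_sq_le_two`):
`ℓ · ‖x_j″ τ‖ ≤ 8πRb (N/(πθpρd) + (½+θp⁻¹)Rwd)/θp + 24π(½+θp⁻¹)Rb²/θp` for `log Γ ≥ 1` (`ℓ = Rb√(Γ log Γ)`; the envelope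
`…LiaRefEnvelope.IsLiaReference.curvature_envelope` with partner-line distance `≥ ρd√Γ/2`).  In the residual form of the F2-d derivative
(`…LiaDefectDerivResidualForm`) this makes the terms `⟪R,P′⟫P`, `⟪R,P⟫P′` cost `ℓ‖P′‖·‖R‖ ≤ K·‖R‖`, i.e. RATE B by `…LiaResidualBound.liaResidual_bound`.
-/

set_option linter.dupNamespace false -- `NavierStokesRegularity.NavierStokesRegularity` path/namespace repetition is the tree convention

noncomputable section

namespace Summit.NavierStokesRegularity.NavierStokesRegularity.Theorems.SkeletonJ1RFrame

open Set Function Filter Real Topology MeasureTheory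
open Literature.Analysis.FluidPDE
open scoped InnerProductSpace BigOperators

/-- **THE COLLAR CURVATURE OF THE LIA REFERENCE IS `O(1/ℓ)` UNIFORMLY IN `Γ`** (see the module docstring for the hypotheses and the constant). [folklore] -/
theorem collar_curvature_mul_le (N : ℕ) {θp ρd Rwd Rb : ℝ} (hθp : 0 < θp) (hρ : 0 < ρd) (hRwd : 0 ≤ Rwd) (hRb : 0 < Rb)
    {Γ θg : ℝ} {p t : Fin N → EuclideanSpace ℝ (Fin 3)} {γ : Fin N → ℝ} {α : ℝ} {s₀ : Fin N → ℝ}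
    {x : Fin N → ℝ → EuclideanSpace ℝ (Fin 3)} (hΓ : 1 < Γ) (hL1 : 1 ≤ Real.log Γ) (hx : IsLiaReference Γ Rb p t γ α s₀ x)
    (ht : ∀ k, ‖t k‖ = 1) (hθg : 0 < θg) (hθg1 : θg ≤ 1) (hgp : ∀ j k, j ≠ k → |inner ℝ (t j) (t k)| ≤ 1 - θg)
    (hsep : ∀ j k, j ≠ k → ∀ a b : ℝ, ρd ≤ ‖(p j + a • t j) - (p k + b • t k)‖) (j : Fin N) {θ₁ : ℝ} (hθ₁0 : 0 ≤ θ₁)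
    (hθ₁A : ∀ k, k ≠ j → θ₁ ≤ min (Real.sqrt θg / 4) (θg * ρd / (16 * (‖(p j + s₀ j • t j) - (p k + s₀ k • t k)‖ + ρd))))
    (htilt : ∀ σ, ‖deriv (x j) σ - t j‖ ≤ θ₁) (hγlo : θp ≤ |γ j|) (hγhi : ∀ k, |γ k| ≤ θp⁻¹) (hα : |α| ≤ θp⁻¹)
    (hq : ∀ k, ‖p k + s₀ k • t k‖ ≤ Rwd) {τ : ℝ} (hτ : |τ| ≤ 3 * Rb * Real.sqrt Γ * Real.sqrt (Real.log Γ)) :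
    Rb * Real.sqrt (Γ * Real.log Γ) * ‖deriv (deriv (x j)) τ‖ ≤
      8 * Real.pi * Rb * (N / (Real.pi * θp * ρd) + (1 / 2 + θp⁻¹) * Rwd) / θp + 24 * Real.pi * (1 / 2 + θp⁻¹) * Rb ^ 2 / θp := by
  -- Γ-level quantities
  have hΓ0 : 0 < Γ := by linarith
  set G := Real.sqrt Γ with hG
  have hG0 : 0 < G := Real.sqrt_pos.2 hΓ0
  have hGG : G ^ 2 = Γ := Real.sq_sqrt hΓ0.le
  set L := Real.log Γ with hL
  have hL0 : 0 < L := by linarith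
  set sL := Real.sqrt L with hsL
  have hsL0 : 0 < sL := Real.sqrt_pos.2 hL0
  have hsLL : sL ^ 2 = L := Real.sq_sqrt hL0.le
  have hsL1 : 1 ≤ sL := by rw [hsL, ← Real.sqrt_one]; exact Real.sqrt_le_sqrt hL1
  have hsqrtΓL : Real.sqrt (Γ * L) = G * sL := Real.sqrt_mul hΓ0.le L
  set ℓ := Rb * Real.sqrt (Γ * Real.log Γ) with hℓdef
  have hℓeq : ℓ = Rb * G * sL := by rw [hℓdef, ← hL, hsqrtΓL, mul_assoc]
  have hℓ0 : 0 < ℓ := by rw [hℓeq]; positivity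
  -- datum constants
  set B₀ : ℝ := N / (Real.pi * θp * ρd) with hB₀
  set Q₀ : ℝ := 1 / 2 + θp⁻¹ with hQ₀
  have hB₀0 : 0 ≤ B₀ := by positivity
  have hQ₀0 : 0 < Q₀ := by positivity
  have hQ : 1 / 2 + |α| ≤ Q₀ := by rw [hQ₀]; linarith
  -- |β⁻¹| ≤ b
  set b : ℝ := 8 * Real.pi / (θp * Γ * L) with hb
  have hb0 : 0 < b := by positivity
  have hγj : 0 < |γ j| := hθp.trans_le hγlo
  have hβinv : |(liaCoeff Γ γ j)⁻¹| ≤ b := by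
    rw [abs_inv]; unfold liaCoeff
    rw [hb, abs_div, abs_mul, abs_mul, abs_of_pos hΓ0, abs_of_pos hL0, abs_of_pos (by positivity : (0:ℝ) < 8 * Real.pi), inv_div]
    refine div_le_div_of_nonneg_left (by positivity) (by positivity) ?_
    calc θp * Γ * L = θp * (Γ * L) := by ring
      _ ≤ |γ j| * (Γ * L) := mul_le_mul_of_nonneg_right hγlo (by positivity)
      _ = Γ * |γ j| * L := by ring
  have h4π : (0:ℝ) < 4 * Real.pi := by positivity
  have hγθ : ∀ k, |γ k| * θp ≤ 1 := fun k => by rw [← le_div_iff₀ hθp, one_div]; exact hγhi k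
  -- partner-line distances and the partner sum
  set d : ℝ := ρd / 2 * G with hd
  have hd0 : 0 < d := by positivity
  set Bd : ℝ := ∑ k ∈ Finset.univ.erase j, |Γ*γ k/(4*Real.pi)| * (2 / (ρd / 2 * G)) with hBd
  have hBdle : Bd ≤ B₀ * G := by
    have hterm : ∀ k ∈ Finset.univ.erase j, |Γ*γ k/(4*Real.pi)| * (2 / (ρd / 2 * G)) ≤ G / (Real.pi * θp * ρd) := by
      intro k _
      rw [abs_div, abs_mul, abs_of_pos hΓ0, abs_of_pos h4π, ← hGG]
      have e1 : G ^ 2 * |γ k| / (4 * Real.pi) * (2 / (ρd / 2 * G)) = (|γ k| * θp) * (G / (Real.pi * θp * ρd)) := by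
        field_simp; norm_num
      rw [e1]
      calc (|γ k| * θp) * (G / (Real.pi * θp * ρd)) ≤ 1 * (G / (Real.pi * θp * ρd)) :=
            mul_le_mul_of_nonneg_right (hγθ k) (by positivity)
        _ = G / (Real.pi * θp * ρd) := one_mul _
    calc Bd ≤ ∑ k ∈ Finset.univ.erase j, G / (Real.pi * θp * ρd) := Finset.sum_le_sum hterm
      _ = (Finset.univ.erase j).card * (G / (Real.pi * θp * ρd)) := by rw [Finset.sum_const, nsmul_eq_mul]
      _ ≤ N * (G / (Real.pi * θp * ρd)) := by
          refine mul_le_mul_of_nonneg_right ?_ (by positivity)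
          have : (Finset.univ.erase j).card ≤ N := by
            rw [Finset.card_erase_of_mem (Finset.mem_univ j), Finset.card_univ, Fintype.card_fin]; exact Nat.sub_le N 1
          exact_mod_cast this
      _ = B₀ * G := by rw [hB₀]; ring
  have hw : ‖waistPt Γ p t s₀ j‖ ≤ Rwd * G := by
    rw [waistPt_eq, norm_smul, Real.norm_of_nonneg hG0.le, mul_comm]; exact mul_le_mul_of_nonneg_right (hq j) hG0.le
  -- the curvature envelope at τ
  have hfarτ := hx.dist_partner_ge_of_tilt ht hθg hθg1 hgp hρ hsep j hθ₁0 hθ₁A htilt τ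
  have henv := hx.curvature_envelope ht j τ hd0 hfarτ
  have hx2 : ‖deriv (deriv (x j)) τ‖ ≤ b * (B₀ * G + Q₀ * (Rwd * G) + Q₀ * |τ|) := by
    have h2 : (∑ k ∈ Finset.univ.erase j, |Γ*γ k/(4*Real.pi)| * (2 / d)) + (1/2 + |α|) * (‖waistPt Γ p t s₀ j‖ + |τ|) ≤
        B₀ * G + Q₀ * (Rwd * G) + Q₀ * |τ| := by
      rw [hd, ← hBd]
      have hm : (1/2 + |α|) * (‖waistPt Γ p t s₀ j‖ + |τ|) ≤ Q₀ * (Rwd * G + |τ|) :=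
        mul_le_mul hQ (add_le_add hw (le_refl |τ|)) (by positivity) hQ₀0.le
      linarith
    calc ‖deriv (deriv (x j)) τ‖ ≤ _ := henv
      _ ≤ b * (B₀ * G + Q₀ * (Rwd * G) + Q₀ * |τ|) := mul_le_mul hβinv h2 (by positivity) hb0.le
  -- ℓ · b in closed form
  have hℓbG : ℓ * b * G = 8 * Real.pi * Rb / (θp * sL) := by
    rw [hℓeq, hb, ← hGG, ← hsLL]; field_simp
  have hℓbG' : ℓ * b * G ≤ 8 * Real.pi * Rb / θp := by
    rw [hℓbG, div_le_div_iff₀ (by positivity) hθp]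
    calc 8 * Real.pi * Rb * θp = 8 * Real.pi * Rb * (θp * 1) := by ring
      _ ≤ 8 * Real.pi * Rb * (θp * sL) := by gcongr
  have hℓbτ : ℓ * b * |τ| ≤ 24 * Real.pi * Rb ^ 2 / θp := by
    have h1 : ℓ * b * |τ| ≤ ℓ * b * (3 * Rb * G * sL) := mul_le_mul_of_nonneg_left hτ (by positivity)
    have h2 : ℓ * b * (3 * Rb * G * sL) = 24 * Real.pi * Rb ^ 2 / θp := by
      rw [hℓeq, hb, ← hGG, ← hsLL]; field_simp; norm_num
    linarith
  -- assemble
  calc ℓ * ‖deriv (deriv (x j)) τ‖ ≤ ℓ * (b * (B₀ * G + Q₀ * (Rwd * G) + Q₀ * |τ|)) :=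
        mul_le_mul_of_nonneg_left hx2 hℓ0.le
    _ = (ℓ * b * G) * (B₀ + Q₀ * Rwd) + Q₀ * (ℓ * b * |τ|) := by ring
    _ ≤ (8 * Real.pi * Rb / θp) * (B₀ + Q₀ * Rwd) + Q₀ * (24 * Real.pi * Rb ^ 2 / θp) := by
        gcongr
    _ = 8 * Real.pi * Rb * (N / (Real.pi * θp * ρd) + (1 / 2 + θp⁻¹) * Rwd) / θp + 24 * Real.pi * (1 / 2 + θp⁻¹) * Rb ^ 2 / θp := by
        rw [hB₀, hQ₀]; ring

end Summit.NavierStokesRegularity.NavierStokesRegularity.Theorems.SkeletonJ1RFrame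

end
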